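import Summits.AtomisticToContinuum.FouriersLaw.Theorems.BondHeatUncertaintyBoundedResponseStorageLeakA
import Summits.AtomisticToContinuum.FouriersLaw.Theorems.BondHeatUncertaintyBoundedResponseEnergyFluctuation
import Summits.AtomisticToContinuum.FouriersLaw.Theorems.BondHeatUncertaintyExtensiveSnapshotIrreversibilityLateOddResponseOfOddCorrector
import HarnessLib

/-!
# NODE 99L «OddCorrectorFromGrade» (lens-1 g99, second node): the corrector grade (C₁) discharges the
`N`-UNIFORM stub S4o `stub_oddCorrectorBound` (hence S4 `stub_lateOddResponse`) of the
`ExtensiveSnapshotIrreversibility` (9121) line `clausius-budget-sound-window`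

Decomposition cell `decomp-a2c`, lens «grading / quantitative ladder», generation 99, beneath the tree nodes
`…BondHeatUncertaintyBoundedResponseStorageLeakA` ((C₁) `CorrectorGrade 1`, (V) `EnergyFluctuationExtensive`, the
Kubo-corrector toolkit `kinObs / kinAct / kinCorrector`), `…BondHeatUncertaintyBoundedResponseEnergyFluctuation` ((V) PROVED)
and `…ExtensiveSnapshotIrreversibilityLateOddResponseOfOddCorrector` (the 9121 lead's landed `S4o ⟹ S4`), AIMED AT the
registered skeleton v10 of the ledger crux item stmt-AtomisticToContinuum-9121,
`Cruxes/ExtensiveSnapshotIrreversibility/Lines/clausius_budget_sound_window.lean`: its open stubs are S1r′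
`stub_oddLogDensityRegularity` (FIXED `N`, the `K_fix`-side debt) and S4k `stub_kuboCorrectorOddCubicBound` (`N`-UNIFORM,
implied by the sibling crux E1 `ConeScaleCorrector`, stmt-14069, via the landed bridge `kuboCorrectorOddCubic_of_coneScale`);
S4o `stub_oddCorrectorBound` — `∫ (w − w∘Θ)² dμ_T ≤ C·N` for the McLennan corrector `w = ∫_{(0,∞)} P_s g ds`,
`g = (γ/2T²)(p_0² − p_{N−1}²)`, "the crux's whole `N`-uniform content" — is DERIVED from S4k, and S4 from S4o
(`lateOddResponse_of_oddCorrectorBound`).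

## Content (0 definitions; every object is the tree's or the stub's own `let`-dictionary)

* `correctorGrade_one_forall` — the all-`N` form of (C₁): `CorrectorGrade 1` gives, for every parameter point and
  `T > 0`, ONE constant `C ≥ 0` with `‖h₀‖²_{L²(μ_{N,T})} ≤ C·N` for EVERY `N ≥ 1` (the finitely many `N < N₀` are
  absorbed into the constant; no analysis).
* `oddCorrector_core` — at fixed `N ≥ 2`: the stub's corrector IS the lens's corrector pair, `w = (γ/2T²)(h₀ − h_{N−1})`
  POINTWISE (`h_b = kinCorrector b = ∫_{(0,∞)} P_t(p_b² − T) dt`; linearity needs only the kernel exponential moments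
  and the absolute convergence `kinAct_integrableOn`), and by the energy coboundary `h₀ + h_{N−1} = (H − ⟨H⟩)/γ` a.e.
  (`kinCorrector_pair_ae_eq`; the 9121 line's `heatCommittor_sumRule` is the same identity for `Q_i = γh_i`):
  `∫ (w − w∘Θ)² dμ_T ≤ 4‖w‖² ≤ 32a²‖h₀‖² + (8a²/γ²)·Var_{μ_T}(H)`, `a = γ/(2T²)` (flip invariance of `μ_T`, `(x − y)² ≤ 2x² + 2y²`).
* `oddCorrectorBound_of_correctorGrade_one : CorrectorGrade 1 → ⟨S4o verbatim⟩` (the all-`N` (C₁) and the tree's (V)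
  `energyFluctuationExtensive_holds`, `Var(H) ≤ C_V·N`), and `lateOddResponse_of_correctorGrade_one : CorrectorGrade 1 →
  ⟨S4 verbatim⟩` (composition with the tree's `lateOddResponse_of_oddCorrectorBound`).

## What it says for the map (no item closes)

(C₁) — equivalently the route item `KineticCorrectorBudget` (33857), by GEN 99C `kineticCorrectorBudget_iff_correctorGrade_one`;
in the 9121 line's vocabulary the "extensive Fisher information / heat-committor variance" S4f/S4v (`Q_L = γh₀`) — is a COMMON
`N`-uniform leg of BOTH residual items of N_F: `BoundedResponse` (11071) ⟸ (D_F) ∧ (C₁) (door v6 in normal form, GEN 99C)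
and `ExtensiveSnapshotIrreversibility` (9121) ⟸ S1r′ ∧ (C₁) (this file + the landed stubs/reductions + the skeleton's
sorry-free composition `ExtensiveSnapshotIrreversibility_of`). So modulo the single (K)-class statement (C₁), N_F reduces to
the time-side (D_F) and the fixed-`N` regularity debt S1r′. (C₁) sits strictly above S4o (even sector included), beside
E1 ⟹ S4k ⟺ S4o. Tag: NORMAL-FORM · TRUE (as an implication) · helper · the `N`-uniform half of (K), not `K_fix` · no rung.

References: J. A. McLennan, Phys. Rev. 115 (1959) 1405 (the corrector); F. Bonetto, J. L. Lebowitz, L. Rey-Bellet,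
*Fourier's law: a challenge to theorists* (2000), §5.2 eq. (25) (energy coboundary); N. Cuneo, J.-P. Eckmann,
M. Hairer, L. Rey-Bellet, EJP 23 (2018) no. 55, Thm 2.13 / §3 eq. (3.4) (Harris package, kernel exponential moments).
-/

noncomputable section

open MeasureTheory ProbabilityTheory Filter Topology Set InformationTheory
open scoped ENNReal NNReal
open Literature.MathematicalPhysics.KineticTheory.HeatConduction
open Literature.MathematicalPhysics.KineticTheory
open Summit.AtomisticToContinuum.FouriersLaw.Theorems.SubdiffusiveBondHeat
open Summit.AtomisticToContinuum.FouriersLaw.Theorems.OddSectorIrreversibility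
open Summit.AtomisticToContinuum.FouriersLaw.Cruxes.SuperadditiveResistance.FloatingProbeBypassLaplacian
  (integral_flip_gibbsMeasure)

namespace Summit.AtomisticToContinuum.FouriersLaw.Theorems.BoundedResponse.ParityFloor

variable {ω₂ lam β γ T : ℝ} {N : ℕ}

section OddCorrectorFromGrade

/-! ## §A The all-`N` form of the corrector grade -/

/-- **(C₁) for every `N ≥ 1`.** `CorrectorGrade 1` (an eventual-in-`N` bound `‖h₀‖² ≤ C·N^1`) yields one constant
`C ≥ 0` with `∫ h₀² dμ_{N,T} ≤ C·N` for ALL `N ≥ 1`: the finitely many `N < N₀` are absorbed (each `∫ h₀² dμ_{N,T}` is a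
real number `≥ 0`, and `N ≥ 1`). [formal bookkeeping] -/
theorem correctorGrade_one_forall (hC : CorrectorGrade 1) :
    ∀ ω₂ lam β γ : ℝ, 0 < ω₂ → 0 < lam → 0 < β → 0 < γ → ∀ T : ℝ, 0 < T →
      ∃ C : ℝ, 0 ≤ C ∧ ∀ (N : ℕ) (hN : 0 < N),
        ∫ z, kinCorrector ω₂ lam β γ T N ⟨0, hN⟩ z ^ 2 ∂((pinnedChain ω₂ lam β γ).gibbsMeasure N T) ≤ C * (N : ℝ) := by
  intro ω₂ lam β γ hω hl hβ hγ T hT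
  obtain ⟨C, N₀, hCN⟩ := hC ω₂ lam β γ hω hl hβ hγ T hT
  set F : ℕ → ℝ := fun n =>
    if h : 0 < n then ∫ z, kinCorrector ω₂ lam β γ T n ⟨0, h⟩ z ^ 2 ∂((pinnedChain ω₂ lam β γ).gibbsMeasure n T)
    else 0 with hF
  have hF0 : ∀ n, 0 ≤ F n := fun n => by
    by_cases h : 0 < n
    · simp only [hF, dif_pos h]; exact integral_nonneg fun _ => sq_nonneg _
    · simp only [hF, dif_neg h]; exact le_rfl
  set S : ℝ := ∑ n ∈ Finset.range N₀, F n with hS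
  have hS0 : 0 ≤ S := Finset.sum_nonneg fun n _ => hF0 n
  refine ⟨max C 0 + S, by positivity, fun N hN => ?_⟩
  have hN1 : (1 : ℝ) ≤ N := by exact_mod_cast hN
  have hFN : F N = ∫ z, kinCorrector ω₂ lam β γ T N ⟨0, hN⟩ z ^ 2 ∂((pinnedChain ω₂ lam β γ).gibbsMeasure N T) := by
    simp only [hF, dif_pos hN]
  by_cases hle : N₀ ≤ N
  · have h := hCN N hN hle
    rw [Real.rpow_one] at h
    have h2 : C * (N : ℝ) ≤ max C 0 * (N : ℝ) := mul_le_mul_of_nonneg_right (le_max_left _ _) (by positivity)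
    nlinarith
  · have hlt : N < N₀ := not_le.mp hle
    have hle' : F N ≤ S := Finset.single_le_sum (fun n _ => hF0 n) (Finset.mem_range.2 hlt)
    rw [← hFN]
    calc F N ≤ S := hle'
      _ ≤ S * (N : ℝ) := le_mul_of_one_le_right hS0 hN1
      _ ≤ (max C 0 + S) * (N : ℝ) := by nlinarith [le_max_right C 0]

/-! ## §B Fixed `N ≥ 2`: the stub's corrector is `(γ/2T²)(h₀ − h_{N−1})`, and its reversal defect is at most
`32a²‖h₀‖² + (8a²/γ²)Var(H)` -/

/-- **Core of S4o from the corrector grade, at one `N ≥ 2`.** With the `let`-dictionary of `stub_oddCorrectorBound` passed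
by defining equations (`g, Pg, w`): `∫ (w − w∘Θ)² dμ_T ≤ (32a²C₁ + 8a²C_V/γ²)·N`, `a = γ/(2T²)`, whenever `‖h₀‖² ≤ C₁N`
and `Var_{μ_T}(H) ≤ C_V N` at this `N`. Steps: `w = a(h₀ − h_{N−1})` pointwise; `h_{N−1} = (H − ⟨H⟩)/γ − h₀` a.e.;
`(x−y)² ≤ 2x² + 2y²` twice and `Θ_*μ_T = μ_T`. [formal bookkeeping] -/
theorem oddCorrector_core (hω : 0 < ω₂) (hl : 0 < lam) (hβ : 0 < β) (hγ : 0 < γ) (hT : 0 < T) (hN : 2 ≤ N)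
    {C₁ CV : ℝ}
    (hC₁ : ∫ z, kinCorrector ω₂ lam β γ T N ⟨0, by omega⟩ z ^ 2 ∂((pinnedChain ω₂ lam β γ).gibbsMeasure N T) ≤
      C₁ * (N : ℝ))
    (hV : ∫ z, ((pinnedChain ω₂ lam β γ).hamiltonian N z -
        ∫ x, (pinnedChain ω₂ lam β γ).hamiltonian N x ∂((pinnedChain ω₂ lam β γ).gibbsMeasure N T)) ^ 2
        ∂((pinnedChain ω₂ lam β γ).gibbsMeasure N T) ≤ CV * (N : ℝ))
    (g : PhaseSpace N → ℝ)
    (hg : g = fun y => γ / (2 * T ^ 2) * (y.2 ⟨0, by omega⟩ ^ 2 - y.2 ⟨N - 1, by omega⟩ ^ 2))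
    (Pg : ℝ → PhaseSpace N → ℝ)
    (hPg : Pg = fun s z => ∫ y, g y ∂((pinnedChain ω₂ lam β γ).transitionKernel N T T s.toNNReal z))
    (w : PhaseSpace N → ℝ) (hw : w = fun z => ∫ s in Set.Ioi (0 : ℝ), Pg s z) :
    ∫ z, (w z - w (z.1, -z.2)) ^ 2 ∂((pinnedChain ω₂ lam β γ).gibbsMeasure N T) ≤
      (32 * (γ / (2 * T ^ 2)) ^ 2 * C₁ + 8 * (γ / (2 * T ^ 2)) ^ 2 / γ ^ 2 * CV) * (N : ℝ) := by
  have hN0 : 0 < N := by omega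
  obtain ⟨hϑ0, -, hϑ1⟩ := weight_facts hT
  obtain ⟨K, c, hK, hc, hb⟩ := harrisBound_exists hω hl.le hβ hγ hN0 hT hϑ0 hϑ1
  obtain ⟨h0sm, h0sq, h0fsm, h0fsq⟩ := corrector_sq_facts hω hl.le hβ hγ hN0 hT (⟨0, by omega⟩ : Fin N)
  obtain ⟨h1sm, h1sq, h1fsm, h1fsq⟩ := corrector_sq_facts hω hl.le hβ hγ hN0 hT (⟨N - 1, by omega⟩ : Fin N)
  obtain ⟨-, -, hHsq⟩ := centredHamiltonian_facts hω hl.le hβ hγ hN0 hT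
  have hpair := kinCorrector_pair_ae_eq hω hl.le hβ hγ hN hT
  -- abbreviations (introduced after the facts, so that the facts are rewritten into them)
  set μT := (pinnedChain ω₂ lam β γ).gibbsMeasure N T with hμT
  set a : ℝ := γ / (2 * T ^ 2) with ha
  set h0 : PhaseSpace N → ℝ := kinCorrector ω₂ lam β γ T N ⟨0, by omega⟩ with hh0
  set h1 : PhaseSpace N → ℝ := kinCorrector ω₂ lam β γ T N ⟨N - 1, by omega⟩ with hh1
  set Hc : PhaseSpace N → ℝ := fun z => (pinnedChain ω₂ lam β γ).hamiltonian N z -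
      ∫ x, (pinnedChain ω₂ lam β γ).hamiltonian N x ∂μT with hHc
  -- §B.1 kernel integrability of `θ_b` and the pointwise identification of `Pg` and `w`
  have hObs : ∀ (b : Fin N) (s : ℝ) (z : PhaseSpace N),
      Integrable (kinObs T N b) ((pinnedChain ω₂ lam β γ).transitionKernel N T T s.toNNReal z) := by
    intro b s z
    have hE := pinnedChain_integrable_exp_mul_hamiltonian_transitionKernel hω hl.le hT hβ.le hγ.le hN0 hϑ0 hϑ1
      s.toNNReal z
    refine (hE.const_mul (2 / (1 / (4 * T)) + T)).mono' (continuous_kinObs T b).aestronglyMeasurable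
      (Eventually.of_forall fun y => ?_)
    rw [Real.norm_eq_abs]
    exact abs_kinObs_le hω hl.le hβ.le hT.le hϑ0 b y
  have hPgpt : ∀ (s : ℝ) (z : PhaseSpace N),
      Pg s z = a * (kinAct ω₂ lam β γ T N ⟨0, by omega⟩ s z - kinAct ω₂ lam β γ T N ⟨N - 1, by omega⟩ s z) := by
    intro s z
    rw [hPg, hg]
    show ∫ y, γ / (2 * T ^ 2) * (y.2 ⟨0, by omega⟩ ^ 2 - y.2 ⟨N - 1, by omega⟩ ^ 2)
        ∂((pinnedChain ω₂ lam β γ).transitionKernel N T T s.toNNReal z) = _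
    have hfun : (fun y : PhaseSpace N => γ / (2 * T ^ 2) * (y.2 ⟨0, by omega⟩ ^ 2 - y.2 ⟨N - 1, by omega⟩ ^ 2)) =
        fun y => γ / (2 * T ^ 2) * (kinObs T N ⟨0, by omega⟩ y - kinObs T N ⟨N - 1, by omega⟩ y) := by
      funext y; simp only [kinObs]; ring
    rw [hfun, integral_const_mul, integral_sub (hObs _ s z) (hObs _ s z)]
    rfl
  have hwpt : ∀ z : PhaseSpace N, w z = a * (h0 z - h1 z) := by
    intro z
    rw [hw]
    show ∫ s in Set.Ioi (0 : ℝ), Pg s z = _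
    simp only [hPgpt]
    rw [integral_const_mul, integral_sub (kinAct_integrableOn hω hl.le hβ hγ hT hϑ0 hb hc _ z).1
      (kinAct_integrableOn hω hl.le hβ hγ hT hϑ0 hb hc _ z).1]
    rfl
  set W : PhaseSpace N → ℝ := fun z => a * (h0 z - h1 z) with hW
  have hwW : w = W := funext hwpt
  rw [hwW]
  -- §B.2 square-integrability of `W` and `W∘Θ`
  have hm0 : MemLp h0 2 μT := (memLp_two_iff_integrable_sq h0sm.aestronglyMeasurable).2 h0sq
  have hm1 : MemLp h1 2 μT := (memLp_two_iff_integrable_sq h1sm.aestronglyMeasurable).2 h1sq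
  have hm0f : MemLp (fun z : PhaseSpace N => h0 (z.1, -z.2)) 2 μT :=
    (memLp_two_iff_integrable_sq h0fsm.aestronglyMeasurable).2 h0fsq
  have hm1f : MemLp (fun z : PhaseSpace N => h1 (z.1, -z.2)) 2 μT :=
    (memLp_two_iff_integrable_sq h1fsm.aestronglyMeasurable).2 h1fsq
  have hWm : MemLp W 2 μT := (hm0.sub hm1).const_mul a
  have hWfm : MemLp (fun z : PhaseSpace N => W (z.1, -z.2)) 2 μT := (hm0f.sub hm1f).const_mul a
  have hW2 : Integrable (fun z => W z ^ 2) μT := (memLp_two_iff_integrable_sq hWm.1).1 hWm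
  have hWf2 : Integrable (fun z : PhaseSpace N => W (z.1, -z.2) ^ 2) μT :=
    (memLp_two_iff_integrable_sq hWfm.1).1 hWfm
  -- §B.3 the a.e. majorant from the energy coboundary, integrated
  have hmaj : ∀ᵐ z ∂μT, W z ^ 2 ≤ 8 * a ^ 2 * h0 z ^ 2 + 2 * a ^ 2 / γ ^ 2 * Hc z ^ 2 := by
    filter_upwards [hpair] with z hz
    have h1z : h1 z = Hc z / γ - h0 z := by
      have hz' : h0 z + h1 z = Hc z / γ := hz
      linarith
    have e : 8 * a ^ 2 * h0 z ^ 2 + 2 * a ^ 2 / γ ^ 2 * Hc z ^ 2 - (a * (h0 z - (Hc z / γ - h0 z))) ^ 2 =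
        (a * (2 * h0 z + Hc z / γ)) ^ 2 := by
      ring
    rw [show W z = a * (h0 z - h1 z) from rfl, h1z]
    linarith [sq_nonneg (a * (2 * h0 z + Hc z / γ)), e]
  have hIW : ∫ z, W z ^ 2 ∂μT ≤ 8 * a ^ 2 * (C₁ * N) + 2 * a ^ 2 / γ ^ 2 * (CV * N) := by
    have h1 : ∫ z, W z ^ 2 ∂μT ≤ ∫ z, (8 * a ^ 2 * h0 z ^ 2 + 2 * a ^ 2 / γ ^ 2 * Hc z ^ 2) ∂μT :=
      integral_mono_ae hW2 ((h0sq.const_mul _).add (hHsq.const_mul _)) hmaj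
    have h2 : ∫ z, (8 * a ^ 2 * h0 z ^ 2 + 2 * a ^ 2 / γ ^ 2 * Hc z ^ 2) ∂μT =
        8 * a ^ 2 * ∫ z, h0 z ^ 2 ∂μT + 2 * a ^ 2 / γ ^ 2 * ∫ z, Hc z ^ 2 ∂μT := by
      rw [integral_add (h0sq.const_mul _) (hHsq.const_mul _), integral_const_mul, integral_const_mul]
    have h3 := mul_le_mul_of_nonneg_left hC₁ (by positivity : (0 : ℝ) ≤ 8 * a ^ 2)
    have h4 := mul_le_mul_of_nonneg_left hV (by positivity : (0 : ℝ) ≤ 2 * a ^ 2 / γ ^ 2)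
    linarith
  -- §B.4 `D(W) ≤ 4‖W‖²` by flip invariance, and the constant
  have hflip : ∫ z, W (z.1, -z.2) ^ 2 ∂μT = ∫ z, W z ^ 2 ∂μT :=
    integral_flip_gibbsMeasure (pinnedChain ω₂ lam β γ) N T (fun z => W z ^ 2)
  have hD : ∫ z, (W z - W (z.1, -z.2)) ^ 2 ∂μT ≤ 4 * ∫ z, W z ^ 2 ∂μT := by
    have h1 : ∫ z, (W z - W (z.1, -z.2)) ^ 2 ∂μT ≤ ∫ z, (2 * W z ^ 2 + 2 * W (z.1, -z.2) ^ 2) ∂μT :=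
      integral_mono_of_nonneg (Eventually.of_forall fun z => sq_nonneg _) ((hW2.const_mul 2).add (hWf2.const_mul 2))
        (Eventually.of_forall fun z => by
          have e : 2 * W z ^ 2 + 2 * W (z.1, -z.2) ^ 2 - (W z - W (z.1, -z.2)) ^ 2 = (W z + W (z.1, -z.2)) ^ 2 := by
            ring
          linarith [sq_nonneg (W z + W (z.1, -z.2)), e])
    have h2 : ∫ z, (2 * W z ^ 2 + 2 * W (z.1, -z.2) ^ 2) ∂μT = 4 * ∫ z, W z ^ 2 ∂μT := by
      rw [integral_add (hW2.const_mul 2) (hWf2.const_mul 2), integral_const_mul, integral_const_mul, hflip]; ring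
    linarith
  refine hD.trans ?_
  have e : 4 * (8 * a ^ 2 * (C₁ * N) + 2 * a ^ 2 / γ ^ 2 * (CV * N)) =
      (32 * a ^ 2 * C₁ + 8 * a ^ 2 / γ ^ 2 * CV) * (N : ℝ) := by ring
  linarith [hIW]

/-! ## §C The stubs S4o and S4 from (C₁) -/

/-- **(C₁) ⟹ S4o `stub_oddCorrectorBound`** of the line `clausius-budget-sound-window` of crux
`ExtensiveSnapshotIrreversibility` (9121), conclusion VERBATIM the registered (derived) stub: under the guard (unused), for
`T > 0` there is `C` such that for every `N ≥ 2` the McLennan corrector `w = ∫_{(0,∞)} P_s g ds`,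
`g = (γ/2T²)(p_0² − p_{N−1}²)`, has `∫ (w − w∘Θ)² dμ_T ≤ C·N`. Ingredients: `correctorGrade_one_forall`, the tree's (V)
`energyFluctuationExtensive_holds`, `oddCorrector_core`. With GEN 99C (`KineticCorrectorBudget ↔ CorrectorGrade 1`) it reads
`KineticCorrectorBudget ⟹ S4o`. [formal bookkeeping] -/
theorem oddCorrectorBound_of_correctorGrade_one (hC : CorrectorGrade 1) :
    ∀ ω₂ lam β γ : ℝ, 0 < ω₂ → 0 < lam → 0 < β → 0 < γ →
      (∀ (N : ℕ) (T_L T_R : ℝ), 0 < T_L → 0 < T_R → ∀ μ ν : Measure (PhaseSpace N),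
        (pinnedChain ω₂ lam β γ).IsSteadyState N T_L T_R μ →
        (pinnedChain ω₂ lam β γ).IsSteadyState N T_L T_R ν → μ = ν) →
      ∀ T : ℝ, 0 < T → ∃ C : ℝ, ∀ (N : ℕ) (hN : 2 ≤ N),
        let P := pinnedChain ω₂ lam β γ
        let μT := P.gibbsMeasure N T
        let g : PhaseSpace N → ℝ := fun y =>
          γ / (2 * T ^ 2) * (y.2 ⟨0, by omega⟩ ^ 2 - y.2 ⟨N - 1, by omega⟩ ^ 2)
        let Pg : ℝ → PhaseSpace N → ℝ := fun s z => ∫ y, g y ∂(P.transitionKernel N T T s.toNNReal z)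
        let w : PhaseSpace N → ℝ := fun z => ∫ s in Set.Ioi (0 : ℝ), Pg s z
        ∫ z, (w z - w (z.1, -z.2)) ^ 2 ∂μT ≤ C * N := by
  intro ω₂ lam β γ hω hl hβ hγ _huniq T hT
  obtain ⟨C₁, -, hC₁⟩ := correctorGrade_one_forall hC ω₂ lam β γ hω hl hβ hγ T hT
  obtain ⟨CV, hV⟩ := energyFluctuationExtensive_holds ω₂ lam β γ hω hl hβ hγ T hT
  refine ⟨32 * (γ / (2 * T ^ 2)) ^ 2 * C₁ + 8 * (γ / (2 * T ^ 2)) ^ 2 / γ ^ 2 * CV, fun N hN => ?_⟩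
  intro P μT g Pg w
  have hN0 : 0 < N := by omega
  exact oddCorrector_core hω hl hβ hγ hT hN (hC₁ N hN0) (hV N) g rfl Pg rfl w rfl

/-- **(C₁) ⟹ S4 `stub_lateOddResponse`** (conclusion VERBATIM the registered stub: under the guard, for `T > 0` there are
`C` and `c > 0` such that for every `N ≥ 2`, given (INV) and (MIX), SOME `τ ∈ [0, cN]` has `P_τ w ∈ L²(μ_T)` and
`∫ (P_τ w − (P_τ w)∘Θ)² dμ_T ≤ C·N`): `oddCorrectorBound_of_correctorGrade_one` composed with the 9121 lead's landed
`lateOddResponse_of_oddCorrectorBound` (`τ = 0`, `c = 1`). [formal bookkeeping] -/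
theorem lateOddResponse_of_correctorGrade_one (hC : CorrectorGrade 1) :
    ∀ ω₂ lam β γ : ℝ, 0 < ω₂ → 0 < lam → 0 < β → 0 < γ →
      (∀ (N : ℕ) (T_L T_R : ℝ), 0 < T_L → 0 < T_R → ∀ μ ν : Measure (PhaseSpace N),
        (pinnedChain ω₂ lam β γ).IsSteadyState N T_L T_R μ →
        (pinnedChain ω₂ lam β γ).IsSteadyState N T_L T_R ν → μ = ν) →
      ∀ T : ℝ, 0 < T → ∃ C c : ℝ, 0 < c ∧ ∀ (N : ℕ) (hN : 2 ≤ N),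
        let P := pinnedChain ω₂ lam β γ
        let μT := P.gibbsMeasure N T
        (∀ t : ℝ≥0, μT.bind (P.transitionKernel N T T t) = μT) →
        (∀ ϑ : ℝ, 0 < ϑ → ϑ < 1 / T → ∃ C c : ℝ, 0 < C ∧ 0 < c ∧
          ∀ (z : PhaseSpace N) (t : ℝ≥0) (f : PhaseSpace N → ℝ), Continuous f →
            (∀ y, |f y| ≤ Real.exp (ϑ * P.hamiltonian N y)) →
            |(∫ y, f y ∂(P.transitionKernel N T T t z)) - ∫ y, f y ∂μT| ≤
              C * Real.exp (ϑ * P.hamiltonian N z) * Real.exp (-c * t)) →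
        let g : PhaseSpace N → ℝ := fun y =>
          γ / (2 * T ^ 2) * (y.2 ⟨0, by omega⟩ ^ 2 - y.2 ⟨N - 1, by omega⟩ ^ 2)
        let Pg : ℝ → PhaseSpace N → ℝ := fun s z => ∫ y, g y ∂(P.transitionKernel N T T s.toNNReal z)
        let w : PhaseSpace N → ℝ := fun z => ∫ s in Set.Ioi (0 : ℝ), Pg s z
        let Pw : ℝ → PhaseSpace N → ℝ := fun τ z => ∫ x, w x ∂(P.transitionKernel N T T τ.toNNReal z)
        ∃ τ : ℝ, 0 ≤ τ ∧ τ ≤ c * N ∧ MemLp (Pw τ) 2 μT ∧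
          ∫ z, (Pw τ z - Pw τ (z.1, -z.2)) ^ 2 ∂μT ≤ C * N :=
  fun ω₂ lam β γ hω hl hβ hγ hU T hT =>
    Summit.AtomisticToContinuum.FouriersLaw.Theorems.ExtensiveSnapshotIrreversibility.ClausiusBudget.lateOddResponse_of_oddCorrectorBound
      ω₂ lam β γ hω hl hβ hγ hU T hT (oddCorrectorBound_of_correctorGrade_one hC ω₂ lam β γ hω hl hβ hγ hU T hT)

end OddCorrectorFromGrade

end Summit.AtomisticToContinuum.FouriersLaw.Theorems.BoundedResponse.ParityFloor

end
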